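import Literature.Analysis.FunctionSpaces.SchwartzComplete
import Mathlib.MeasureTheory.Integral.IntervalIntegral.Basic
import Mathlib.Analysis.SpecialFunctions.Pow.Real
import HarnessLib

/-!
# Continuous linear maps on the Schwartz space commute with parameter integrals

Analysis/Distribution support file (everything proved; no definitions, no named facts). The
weak-integral principle for the Fréchet space `𝓢(E, F)`: if `t ↦ Φ t` is a continuous curve in
`𝓢(E, F)` and the Schwartz function `Ψ` is its pointwise integral over `[a, b]`,
`Ψ(x) = ∫ₐᵇ Φ t (x) dt` for every `x`, then for every continuous linear map `𝒟` on `𝓢(E, F)`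
(e.g. a tempered distribution)

  `𝒟 Ψ = ∫ₐᵇ 𝒟 (Φ t) dt`

(`SchwartzMap.clm_apply_eq_intervalIntegral`). This is the identity behind "a distribution
applied to a convolution (or a superposition of translates) is the integral of its values on the
translates", `u(ρ * φ) = ∫ ρ(t) u(φ(· − t)) dt` (Hörmander, *ALPDO I*, Thm. 4.1.1/(4.1.1) and
§5.2), in the form needed to average Schwinger functions over the position of a cluster
(Osterwalder–Schrader II, Ch. V–VI).

Proof (Rudin, *Functional Analysis*, Thm. 3.27, specialised to a Fréchet space where Riemann sums
suffice): the Riemann sums `R_N = ∑_{i<N} (c/N) Φ(a + i c/N)`, `c = b − a`, along `N = 2ⁿ` are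
Cauchy in every Schwartz seminorm — comparing `R_{Bk}` with `R_B` block by block
(`sum_range_mul_eq_sum_sum`) costs `c · ω(c/B)` where `ω` is a modulus of uniform continuity of `Φ`
on `[a, b]` in that seminorm — hence converge in the complete space `𝓢(E, F)`
(`Literature.Analysis.FunctionSpaces.completeSpace_schwartzMap`); the limit is `Ψ` because point
evaluations are continuous and the scalar Riemann sums converge to the scalar integrals
(`tendsto_riemannSum_intervalIntegral`); and `𝒟 R_N = ∑ (c/N) 𝒟 Φ(tᵢ) → ∫ 𝒟(Φ t) dt` likewise.

* `sum_range_mul_eq_sum_sum` — `∑_{i<Bk} f i = ∑_{m<B} ∑_{s<k} f(mk + s)`;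
* `norm_riemannSum_sub_intervalIntegral_le`, `tendsto_riemannSum_intervalIntegral` — Riemann sums
  of a continuous function into a Banach space;
* `SchwartzMap.exists_seminorm_sub_lt_of_continuous` — uniform continuity of a continuous curve in
  `𝓢(E, F)` on `[a, b]`, seminorm by seminorm;
* `SchwartzMap.clm_apply_eq_intervalIntegral` — **the theorem**.

## References

* W. Rudin, *Functional Analysis*, 2nd ed. (1991), Thm. 3.27 (integrals of vector-valued
  functions) and Thm. 7.4 (a). [Rudin1991]
* L. Hörmander, *The Analysis of Linear Partial Differential Operators I*, §4.1, §5.2.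
  [HormanderALPDO1]

Everything here is tagged folklore.
-/

noncomputable section

open _root_.MeasureTheory Set Filter intervalIntegral Finset
open scoped _root_.Topology SchwartzMap Uniformity

namespace Literature.Analysis.Distribution

/-! ### Sums in blocks -/

/-- A sum over `i < B k` in `B` blocks of `k` consecutive indices. [folklore] -/
theorem sum_range_mul_eq_sum_sum {M : Type*} [AddCommMonoid M] (f : ℕ → M) (B k : ℕ) :
    ∑ i ∈ range (B * k), f i = ∑ m ∈ range B, ∑ s ∈ range k, f (m * k + s) := by
  induction B with
  | zero => simp
  | succ B ih => rw [Nat.succ_mul, Finset.sum_range_add, ih, Finset.sum_range_succ]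

/-! ### Riemann sums of a continuous function into a Banach space -/

variable {G : Type*} [NormedAddCommGroup G] [NormedSpace ℝ G] [CompleteSpace G]

/-- **Riemann sums against a modulus of continuity**: if `‖g t − g t'‖ ≤ ω` whenever
`t, t' ∈ [a, b]` and `|t − t'| ≤ (b − a)/N`, then the left-endpoint Riemann sum with `N` steps is
within `(b − a) ω` of `∫ₐᵇ g`. [folklore] -/
theorem norm_riemannSum_sub_intervalIntegral_le {g : ℝ → G} (hg : Continuous g) {a b : ℝ}
    (hab : a ≤ b) {N : ℕ} (hN : 0 < N) {ω : ℝ}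
    (hω : ∀ t ∈ Icc a b, ∀ t' ∈ Icc a b, |t - t'| ≤ (b - a) / N → ‖g t - g t'‖ ≤ ω) :
    ‖∑ i ∈ range N, ((b - a) / N) • g (a + i * ((b - a) / N)) - ∫ t in a..b, g t‖ ≤ (b - a) * ω := by
  set Δ : ℝ := (b - a) / N with hΔ
  have hΔ0 : 0 ≤ Δ := div_nonneg (by linarith) (by positivity)
  set s : ℕ → ℝ := fun i => a + i * Δ with hs
  have hs0 : s 0 = a := by simp [hs]
  have hsN : s N = b := by
    rw [hs, hΔ]; field_simp; ring
  have hstep : ∀ i, s (i + 1) - s i = Δ := fun i => by simp [hs]; ring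
  have hmono : ∀ i, s i ≤ s (i + 1) := fun i => by linarith [hstep i]
  have hsI : ∀ i ≤ N, s i ∈ Icc a b := by
    intro i hi
    refine ⟨by simp [hs]; positivity, ?_⟩
    rw [← hsN]
    simp only [hs]
    gcongr
  -- the integral as a sum over the cells
  have hint : ∀ i < N, IntervalIntegrable g volume (s i) (s (i + 1)) := fun i _ =>
    hg.intervalIntegrable _ _
  have hsum : (∫ t in a..b, g t) = ∑ i ∈ range N, ∫ t in s i..s (i + 1), g t := by
    rw [sum_integral_adjacent_intervals hint, hs0, hsN]
  rw [hsum, ← Finset.sum_sub_distrib]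
  -- each cell contributes at most `Δ ω`
  have hcell : ∀ i ∈ range N, ‖Δ • g (a + i * Δ) - ∫ t in s i..s (i + 1), g t‖ ≤ Δ * ω := by
    intro i hi
    have hiN : i < N := Finset.mem_range.1 hi
    have h1 : Δ • g (a + i * Δ) = ∫ _ in s i..s (i + 1), g (s i) := by
      rw [intervalIntegral.integral_const, hstep]
    rw [h1, ← intervalIntegral.integral_sub intervalIntegrable_const (hint i hiN)]
    have h2 := intervalIntegral.norm_integral_le_of_norm_le_const (a := s i) (b := s (i + 1))
      (C := ω) (f := fun t => g (s i) - g t) fun t ht => ?_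
    · rw [hstep i, abs_of_nonneg hΔ0, mul_comm] at h2
      exact h2
    · rw [uIoc_of_le (hmono i)] at ht
      have htI : t ∈ Icc a b :=
        ⟨(hsI i hiN.le).1.trans ht.1.le, ht.2.trans (hsI (i + 1) hiN).2⟩
      refine hω _ (hsI i hiN.le) _ htI ?_
      rw [abs_sub_comm, abs_of_nonneg (by linarith [ht.1])]
      linarith [ht.2, hstep i]
  calc ‖∑ i ∈ range N, (Δ • g (a + i * Δ) - ∫ t in s i..s (i + 1), g t)‖
      ≤ ∑ i ∈ range N, ‖Δ • g (a + i * Δ) - ∫ t in s i..s (i + 1), g t‖ := norm_sum_le _ _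
    _ ≤ ∑ i ∈ range N, Δ * ω := Finset.sum_le_sum hcell
    _ = (b - a) * ω := by
        rw [Finset.sum_const, Finset.card_range, nsmul_eq_mul, hΔ]
        field_simp

/-- **Riemann sums of a continuous function converge to the integral** (left endpoints, `2ⁿ`
steps). [folklore] -/
theorem tendsto_riemannSum_intervalIntegral {g : ℝ → G} (hg : Continuous g) {a b : ℝ} (hab : a ≤ b) :
    Tendsto (fun n : ℕ => ∑ i ∈ range (2 ^ n), ((b - a) / (2 ^ n : ℕ)) • g (a + i * ((b - a) / (2 ^ n : ℕ))))
      atTop (𝓝 (∫ t in a..b, g t)) := by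
  refine Metric.tendsto_atTop.2 fun ε hε => ?_
  obtain ⟨δ, hδ, hU⟩ := Metric.uniformContinuousOn_iff.1
    (isCompact_Icc.uniformContinuousOn_of_continuous hg.continuousOn) (ε / (b - a + 1))
    (by positivity)
  obtain ⟨n₀, hn₀⟩ : ∃ n₀ : ℕ, (b - a) / (2 ^ n₀ : ℕ) < δ := by
    obtain ⟨n₀, hn₀⟩ := exists_nat_gt ((b - a) / δ)
    refine ⟨n₀, ?_⟩
    have h2 : (n₀ : ℝ) < (2 ^ n₀ : ℕ) := by exact_mod_cast Nat.lt_two_pow_self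
    rw [div_lt_iff₀ (by positivity)]
    rw [div_lt_iff₀ hδ] at hn₀
    nlinarith
  refine ⟨n₀, fun n hn => ?_⟩
  rw [dist_eq_norm]
  have hNn : (b - a) / (2 ^ n : ℕ) ≤ (b - a) / (2 ^ n₀ : ℕ) :=
    div_le_div_of_nonneg_left (by linarith) (by positivity)
      (by exact_mod_cast Nat.pow_le_pow_right two_pos hn)
  have h := norm_riemannSum_sub_intervalIntegral_le hg hab (N := 2 ^ n) (by positivity)
    (ω := ε / (b - a + 1)) fun t ht t' ht' htt' => ?_
  · refine h.trans_lt ?_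
    rw [mul_div_assoc', div_lt_iff₀ (by linarith)]
    nlinarith
  · have hd := hU t ht t' ht' (by rw [Real.dist_eq]; exact lt_of_le_of_lt (htt'.trans hNn) hn₀)
    rw [dist_eq_norm] at hd
    exact hd.le

/-! ### Uniform continuity of a continuous curve in the Schwartz space -/

variable {E F : Type*} [NormedAddCommGroup E] [NormedSpace ℝ E] [NormedAddCommGroup F]
  [NormedSpace ℝ F]

/-- A seminorm is subadditive over finite sums. [folklore] -/
theorem seminorm_sum_le {V : Type*} [AddCommGroup V] [Module ℝ V] (p : Seminorm ℝ V) {ι : Type*}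
    (s : Finset ι) (f : ι → V) : p (∑ i ∈ s, f i) ≤ ∑ i ∈ s, p (f i) := by
  classical
  induction s using Finset.induction_on with
  | empty => simp
  | insert i s hi ih =>
      rw [Finset.sum_insert hi, Finset.sum_insert hi]
      exact (map_add_le_add p _ _).trans (by gcongr)

/-- **Uniform continuity of a continuous curve in `𝓢(E, F)` on a compact interval, seminorm by
seminorm**: for every Schwartz seminorm `p_{k,l}` and `ε > 0` there is `δ > 0` with
`p_{k,l}(Φ t − Φ t') < ε` for `t, t' ∈ [a, b]`, `|t − t'| < δ` (the uniformity of the topological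
group `𝓢(E, F)` has the seminorm balls as a basis). [folklore] -/
theorem _root_.SchwartzMap.exists_seminorm_sub_lt_of_continuous {Φ : ℝ → 𝓢(E, F)} (hΦ : Continuous Φ)
    (a b : ℝ) (k l : ℕ) {ε : ℝ} (hε : 0 < ε) :
    ∃ δ : ℝ, 0 < δ ∧ ∀ t ∈ Icc a b, ∀ t' ∈ Icc a b, |t - t'| < δ →
      SchwartzMap.seminorm ℝ k l (Φ t - Φ t') < ε := by
  have hU : UniformContinuousOn Φ (Icc a b) :=
    isCompact_Icc.uniformContinuousOn_of_continuous hΦ.continuousOn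
  have hb := ((schwartz_withSeminorms ℝ E F).hasBasis_zero_ball).comap
    (fun x : 𝓢(E, F) × 𝓢(E, F) => x.2 - x.1)
  rw [← uniformity_eq_comap_nhds_zero] at hb
  rw [UniformContinuousOn, (Metric.uniformity_basis_dist.inf_principal _).tendsto_iff hb] at hU
  obtain ⟨δ, hδ, h⟩ := hU ({(k, l)}, ε) hε
  refine ⟨δ, hδ, fun t ht t' ht' htt' => ?_⟩
  have h' := h (t', t) ⟨by simpa [Real.dist_eq, abs_sub_comm] using htt', ⟨ht', ht⟩⟩
  simpa [Seminorm.mem_ball, Finset.sup_singleton, schwartzSeminormFamily] using h'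

/-! ### The theorems -/

/-- **Riemann sums of a continuous curve in `𝓢(E, F)` converge in `𝓢(E, F)` to the pointwise
integral** (the Fréchet-space content of Rudin, *Functional Analysis*, Thm. 3.27): if
`Φ : ℝ → 𝓢(E, F)` is continuous and `Ψ(x) = ∫ₐᵇ Φ t (x) dt` for every `x`, then the left-endpoint
Riemann sums with `2ⁿ` steps tend to `Ψ` in the Schwartz topology. Proof: they are Cauchy in
every Schwartz seminorm (block comparison `sum_range_mul_eq_sum_sum` and uniform continuity,
`SchwartzMap.exists_seminorm_sub_lt_of_continuous`), hence converge in the complete space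
`𝓢(E, F)` (`Literature.Analysis.FunctionSpaces.completeSpace_schwartzMap`), and the limit is `Ψ`
because point evaluations are continuous and the scalar Riemann sums converge to the scalar
integrals (`tendsto_riemannSum_intervalIntegral`). [folklore] -/
theorem _root_.SchwartzMap.tendsto_riemannSum_of_forall_apply_eq_integral [CompleteSpace F]
    {Φ : ℝ → 𝓢(E, F)} (hΦ : Continuous Φ) {a b : ℝ} (hab : a ≤ b) {Ψ : 𝓢(E, F)}
    (hΨ : ∀ x : E, Ψ x = ∫ t in a..b, Φ t x) :
    Tendsto (fun n : ℕ => ∑ i ∈ range (2 ^ n), ((b - a) / (2 ^ n : ℕ)) • Φ (a + i * ((b - a) / (2 ^ n : ℕ))))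
      atTop (𝓝 Ψ) := by
  haveI : CompleteSpace 𝓢(E, F) := Literature.Analysis.FunctionSpaces.completeSpace_schwartzMap
  -- Riemann sums with `N` steps, and along `N = 2ⁿ`
  set R : ℕ → 𝓢(E, F) := fun N => ∑ i ∈ range N, ((b - a) / N) • Φ (a + i * ((b - a) / N)) with hR
  set u : ℕ → 𝓢(E, F) := fun n => R (2 ^ n) with hu
  show Tendsto u atTop (𝓝 Ψ)
  -- (1) block comparison: `p(R (B k) - R B) ≤ (b - a) ω` if `p(Φ t - Φ t') ≤ ω` for `|t - t'| ≤ (b-a)/B`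
  have hblock : ∀ (p : Seminorm ℝ 𝓢(E, F)) (B k : ℕ), 0 < B → 0 < k → ∀ ω : ℝ,
      (∀ t ∈ Icc a b, ∀ t' ∈ Icc a b, |t - t'| ≤ (b - a) / B → p (Φ t - Φ t') ≤ ω) →
      p (R (B * k) - R B) ≤ (b - a) * ω := by
    intro p B k hB hk ω hω
    set Δ : ℝ := (b - a) / (B * k : ℕ) with hΔ
    have hΔB : (b - a) / B = k * Δ := by
      rw [hΔ]; push_cast; field_simp
    have hΔ0 : 0 ≤ Δ := div_nonneg (by linarith) (by positivity)
    -- rewrite both sums block by block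
    have h1 : R (B * k) = ∑ m ∈ range B, ∑ s ∈ range k, Δ • Φ (a + ((m * k + s : ℕ) : ℝ) * Δ) := by
      simp only [hR]
      rw [sum_range_mul_eq_sum_sum]
    have h2 : R B = ∑ m ∈ range B, ∑ s ∈ range k, Δ • Φ (a + m * ((b - a) / B)) := by
      simp only [hR]
      refine Finset.sum_congr rfl fun m _ => ?_
      rw [Finset.sum_const, Finset.card_range, ← smul_assoc, nsmul_eq_mul, ← hΔB]
    rw [h1, h2, ← Finset.sum_sub_distrib]
    simp_rw [← Finset.sum_sub_distrib, ← smul_sub]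
    calc p (∑ m ∈ range B, ∑ s ∈ range k, Δ • (Φ (a + ((m * k + s : ℕ) : ℝ) * Δ) - Φ (a + m * ((b - a) / B))))
        ≤ ∑ m ∈ range B, ∑ s ∈ range k, p (Δ • (Φ (a + ((m * k + s : ℕ) : ℝ) * Δ) - Φ (a + m * ((b - a) / B)))) :=
          (seminorm_sum_le p _ _).trans (Finset.sum_le_sum fun m _ => seminorm_sum_le p _ _)
      _ ≤ ∑ m ∈ range B, ∑ s ∈ range k, Δ * ω := by
          refine Finset.sum_le_sum fun m hm => Finset.sum_le_sum fun s hs => ?_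
          rw [map_smul_eq_mul, Real.norm_eq_abs, abs_of_nonneg hΔ0]
          refine mul_le_mul_of_nonneg_left (hω _ ?_ _ ?_ ?_) hΔ0
          · -- the fine point lies in `[a, b]`
            have hmB : m < B := Finset.mem_range.1 hm
            have hsk : s < k := Finset.mem_range.1 hs
            have hle : ((m * k + s : ℕ) : ℝ) * Δ ≤ b - a := by
              have : ((m * k + s : ℕ) : ℝ) ≤ (B * k : ℕ) := by
                exact_mod_cast (by nlinarith : m * k + s ≤ B * k)
              calc ((m * k + s : ℕ) : ℝ) * Δ ≤ (B * k : ℕ) * Δ := by gcongr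
                _ = b - a := by rw [hΔ]; field_simp
            exact ⟨by nlinarith [mul_nonneg (Nat.cast_nonneg (m * k + s)) hΔ0], by linarith⟩
          · -- the coarse point lies in `[a, b]`
            have hmB : m < B := Finset.mem_range.1 hm
            have hle : (m : ℝ) * ((b - a) / B) ≤ b - a := by
              rw [hΔB]
              have : (m : ℝ) * (k * Δ) = ((m * k : ℕ) : ℝ) * Δ := by push_cast; ring
              rw [this]
              have : ((m * k : ℕ) : ℝ) ≤ (B * k : ℕ) := by exact_mod_cast Nat.mul_le_mul_right k hmB.le
              calc ((m * k : ℕ) : ℝ) * Δ ≤ (B * k : ℕ) * Δ := by gcongr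
                _ = b - a := by rw [hΔ]; field_simp
            have h0 : 0 ≤ (m : ℝ) * ((b - a) / B) := by rw [hΔB]; positivity
            exact ⟨by linarith, by linarith⟩
          · -- the two points are within `(b - a)/B`
            rw [hΔB]
            have hsk : s < k := Finset.mem_range.1 hs
            have : a + ((m * k + s : ℕ) : ℝ) * Δ - (a + m * (k * Δ)) = s * Δ := by push_cast; ring
            rw [this, abs_of_nonneg (by positivity)]
            exact mul_le_mul_of_nonneg_right (by exact_mod_cast hsk.le) hΔ0
      _ = (b - a) * ω := by
          simp only [Finset.sum_const, Finset.card_range, nsmul_eq_mul]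
          rw [hΔ]
          push_cast
          field_simp
  -- (2) `u` is Cauchy
  have hcauchy : CauchySeq u := by
    rw [Literature.Analysis.FunctionSpaces.cauchySeq_schwartzMap_iff]
    intro k l ε hε
    obtain ⟨δ, hδ, hUC⟩ := SchwartzMap.exists_seminorm_sub_lt_of_continuous hΦ a b k l
      (ε := ε / (2 * (b - a) + 1)) (by positivity)
    obtain ⟨n₀, hn₀⟩ : ∃ n₀ : ℕ, (b - a) / (2 ^ n₀ : ℕ) < δ := by
      obtain ⟨n₀, hn₀⟩ := exists_nat_gt ((b - a) / δ)
      refine ⟨n₀, ?_⟩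
      have h2 : (n₀ : ℝ) < (2 ^ n₀ : ℕ) := by exact_mod_cast Nat.lt_two_pow_self
      rw [div_lt_iff₀ (by positivity)]
      rw [div_lt_iff₀ hδ] at hn₀
      nlinarith
    -- both `u m` and `u n` are within `(b - a) ε'` of `u n₀`
    have hnear : ∀ n, n₀ ≤ n → SchwartzMap.seminorm ℝ k l (u n - u n₀) ≤ (b - a) * (ε / (2 * (b - a) + 1)) := by
      intro n hn
      have hpow : 2 ^ n = 2 ^ n₀ * 2 ^ (n - n₀) := by rw [← pow_add, Nat.add_sub_cancel' hn]
      simp only [hu]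
      rw [hpow]
      refine hblock _ (2 ^ n₀) (2 ^ (n - n₀)) (by positivity) (by positivity) _ fun t ht t' ht' htt' =>
        (hUC t ht t' ht' (htt'.trans_lt hn₀)).le
    refine ⟨n₀, fun m hm n hn => ?_⟩
    calc SchwartzMap.seminorm ℝ k l (u n - u m)
        = SchwartzMap.seminorm ℝ k l ((u n - u n₀) - (u m - u n₀)) := by congr 1; abel
      _ ≤ SchwartzMap.seminorm ℝ k l (u n - u n₀) + SchwartzMap.seminorm ℝ k l (u m - u n₀) :=
          map_sub_le_add _ _ _
      _ ≤ (b - a) * (ε / (2 * (b - a) + 1)) + (b - a) * (ε / (2 * (b - a) + 1)) :=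
          add_le_add (hnear n hn) (hnear m hm)
      _ < ε := by
          rw [← two_mul, ← mul_assoc, mul_div_assoc', div_lt_iff₀ (by linarith)]
          nlinarith
  -- (3) the limit is `Ψ`
  obtain ⟨Ψ', hΨ'⟩ := cauchySeq_tendsto_of_complete hcauchy
  have hΨ'eq : Ψ' = Ψ := by
    ext x
    -- evaluation at `x` is continuous: `|f x| ≤ p₀₀(f)`
    have heval : Tendsto (fun n => u n x) atTop (𝓝 (Ψ' x)) := by
      have hsub : Tendsto (fun n => u n - Ψ') atTop (𝓝 0) := by
        simpa using hΨ'.sub (tendsto_const_nhds (x := Ψ'))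
      have hsem : Tendsto (fun n => SchwartzMap.seminorm ℝ 0 0 (u n - Ψ')) atTop (𝓝 0) := by
        have := ((schwartz_withSeminorms ℝ E F).continuous_seminorm (0, 0)).tendsto 0
        rw [map_zero] at this
        exact this.comp hsub
      rw [tendsto_iff_norm_sub_tendsto_zero]
      refine squeeze_zero (fun n => norm_nonneg _) (fun n => ?_) hsem
      exact SchwartzMap.norm_le_seminorm ℝ (u n - Ψ') x
    -- the scalar Riemann sums converge to the scalar integral
    have hriem : Tendsto (fun n => u n x) atTop (𝓝 (∫ t in a..b, Φ t x)) := by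
      have h := tendsto_riemannSum_intervalIntegral (g := fun t => Φ t x) ?_ hab
      · refine h.congr fun n => ?_
        simp [hu, hR]
      · -- `t ↦ Φ t x` is continuous
        have h1 : Continuous fun t => Φ t - Φ 0 := hΦ.sub continuous_const
        rw [continuous_iff_continuousAt]
        intro t₀
        rw [ContinuousAt, tendsto_iff_norm_sub_tendsto_zero]
        have hsub : Tendsto (fun t => Φ t - Φ t₀) (𝓝 t₀) (𝓝 0) := by
          simpa using (hΦ.tendsto t₀).sub (tendsto_const_nhds (x := Φ t₀))
        have hsem : Tendsto (fun t => SchwartzMap.seminorm ℝ 0 0 (Φ t - Φ t₀)) (𝓝 t₀) (𝓝 0) := by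
          have := ((schwartz_withSeminorms ℝ E F).continuous_seminorm (0, 0)).tendsto 0
          rw [map_zero] at this
          exact this.comp hsub
        refine squeeze_zero (fun t => norm_nonneg _) (fun t => ?_) hsem
        exact SchwartzMap.norm_le_seminorm ℝ (Φ t - Φ t₀) x
    rw [hΨ x]
    exact tendsto_nhds_unique heval hriem
  rw [← hΨ'eq]
  exact hΨ'

/-- **Continuous linear maps on the Schwartz space commute with parameter integrals** (Rudin,
*Functional Analysis*, Thm. 3.27, in the Fréchet space `𝓢(E, F)`): if `Φ : ℝ → 𝓢(E, F)` is
continuous and the Schwartz function `Ψ` satisfies `Ψ(x) = ∫ₐᵇ Φ t (x) dt` for every `x`, then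
`𝒟 Ψ = ∫ₐᵇ 𝒟 (Φ t) dt` for every continuous linear `𝒟 : 𝓢(E, F) →L[ℝ] G` into a Banach space
(in particular for tempered distributions, after `restrictScalars ℝ`). Proof: apply `𝒟` to the
convergent Riemann sums (`SchwartzMap.tendsto_riemannSum_of_forall_apply_eq_integral`). [folklore] -/
theorem _root_.SchwartzMap.clm_apply_eq_intervalIntegral [CompleteSpace F] {Φ : ℝ → 𝓢(E, F)}
    (hΦ : Continuous Φ) {a b : ℝ} (hab : a ≤ b) {Ψ : 𝓢(E, F)}
    (hΨ : ∀ x : E, Ψ x = ∫ t in a..b, Φ t x) (𝒟 : 𝓢(E, F) →L[ℝ] G) :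
    𝒟 Ψ = ∫ t in a..b, 𝒟 (Φ t) := by
  have hu := SchwartzMap.tendsto_riemannSum_of_forall_apply_eq_integral hΦ hab hΨ
  have hD : Tendsto (fun n : ℕ => 𝒟 (∑ i ∈ range (2 ^ n), ((b - a) / (2 ^ n : ℕ)) •
      Φ (a + i * ((b - a) / (2 ^ n : ℕ))))) atTop (𝓝 (𝒟 Ψ)) :=
    (𝒟.continuous.tendsto Ψ).comp hu
  have hD' : Tendsto (fun n : ℕ => 𝒟 (∑ i ∈ range (2 ^ n), ((b - a) / (2 ^ n : ℕ)) •
      Φ (a + i * ((b - a) / (2 ^ n : ℕ))))) atTop (𝓝 (∫ t in a..b, 𝒟 (Φ t))) := by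
    have h := tendsto_riemannSum_intervalIntegral (g := fun t => 𝒟 (Φ t)) (𝒟.continuous.comp hΦ) hab
    refine h.congr fun n => ?_
    simp only [map_sum, map_smul]
  exact tendsto_nhds_unique hD hD'

/-- **Seminorms of a parameter integral in `𝓢(E, F)`**: under the same hypotheses,
`p_{k,l}(Ψ) ≤ ∫ₐᵇ p_{k,l}(Φ t) dt` for every Schwartz seminorm (the seminorm of a Riemann sum is
at most the Riemann sum of the seminorms; pass to the limit). [folklore] -/
theorem _root_.SchwartzMap.seminorm_le_intervalIntegral_of_forall_apply_eq_integral [CompleteSpace F]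
    {Φ : ℝ → 𝓢(E, F)} (hΦ : Continuous Φ) {a b : ℝ} (hab : a ≤ b) {Ψ : 𝓢(E, F)}
    (hΨ : ∀ x : E, Ψ x = ∫ t in a..b, Φ t x) (k l : ℕ) :
    SchwartzMap.seminorm ℝ k l Ψ ≤ ∫ t in a..b, SchwartzMap.seminorm ℝ k l (Φ t) := by
  set p : Seminorm ℝ 𝓢(E, F) := SchwartzMap.seminorm ℝ k l with hp
  have hpc : Continuous p := (schwartz_withSeminorms ℝ E F).continuous_seminorm (k, l)
  have hu := SchwartzMap.tendsto_riemannSum_of_forall_apply_eq_integral hΦ hab hΨ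
  have h1 : Tendsto (fun n : ℕ => p (∑ i ∈ range (2 ^ n), ((b - a) / (2 ^ n : ℕ)) •
      Φ (a + i * ((b - a) / (2 ^ n : ℕ))))) atTop (𝓝 (p Ψ)) := (hpc.tendsto Ψ).comp hu
  have h2 : Tendsto (fun n : ℕ => ∑ i ∈ range (2 ^ n), ((b - a) / (2 ^ n : ℕ)) •
      p (Φ (a + i * ((b - a) / (2 ^ n : ℕ))))) atTop (𝓝 (∫ t in a..b, p (Φ t))) :=
    tendsto_riemannSum_intervalIntegral (g := fun t => p (Φ t)) (hpc.comp hΦ) hab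
  refine le_of_tendsto_of_tendsto' h1 h2 fun n => ?_
  refine (seminorm_sum_le p _ _).trans (Finset.sum_le_sum fun i _ => ?_)
  rw [map_smul_eq_mul, Real.norm_eq_abs, abs_of_nonneg (div_nonneg (by linarith) (by positivity)),
    smul_eq_mul]


/-! ### Existence of the Schwartz-valued integral -/

/-- **The Riemann sums of a continuous curve in `𝓢(E, F)` form a Cauchy sequence** (along
`N = 2ⁿ`): block comparison and uniform continuity, as in
`SchwartzMap.tendsto_riemannSum_of_forall_apply_eq_integral`, but without a candidate limit. [folklore] -/
theorem _root_.SchwartzMap.cauchySeq_riemannSum {Φ : ℝ → 𝓢(E, F)} (hΦ : Continuous Φ) {a b : ℝ}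
    (hab : a ≤ b) :
    CauchySeq fun n : ℕ => ∑ i ∈ range (2 ^ n), ((b - a) / (2 ^ n : ℕ)) •
      Φ (a + i * ((b - a) / (2 ^ n : ℕ))) := by
  set R : ℕ → 𝓢(E, F) := fun N => ∑ i ∈ range N, ((b - a) / N) • Φ (a + i * ((b - a) / N)) with hR
  set u : ℕ → 𝓢(E, F) := fun n => R (2 ^ n) with hu
  show CauchySeq u
  -- (1) block comparison
  have hblock : ∀ (p : Seminorm ℝ 𝓢(E, F)) (B k : ℕ), 0 < B → 0 < k → ∀ ω : ℝ,
      (∀ t ∈ Icc a b, ∀ t' ∈ Icc a b, |t - t'| ≤ (b - a) / B → p (Φ t - Φ t') ≤ ω) →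
      p (R (B * k) - R B) ≤ (b - a) * ω := by
    intro p B k hB hk ω hω
    set Δ : ℝ := (b - a) / (B * k : ℕ) with hΔ
    have hΔB : (b - a) / B = k * Δ := by
      rw [hΔ]; push_cast; field_simp
    have hΔ0 : 0 ≤ Δ := div_nonneg (by linarith) (by positivity)
    have h1 : R (B * k) = ∑ m ∈ range B, ∑ s ∈ range k, Δ • Φ (a + ((m * k + s : ℕ) : ℝ) * Δ) := by
      simp only [hR]
      rw [sum_range_mul_eq_sum_sum]
    have h2 : R B = ∑ m ∈ range B, ∑ s ∈ range k, Δ • Φ (a + m * ((b - a) / B)) := by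
      simp only [hR]
      refine Finset.sum_congr rfl fun m _ => ?_
      rw [Finset.sum_const, Finset.card_range, ← smul_assoc, nsmul_eq_mul, ← hΔB]
    rw [h1, h2, ← Finset.sum_sub_distrib]
    simp_rw [← Finset.sum_sub_distrib, ← smul_sub]
    calc p (∑ m ∈ range B, ∑ s ∈ range k, Δ • (Φ (a + ((m * k + s : ℕ) : ℝ) * Δ) - Φ (a + m * ((b - a) / B))))
        ≤ ∑ m ∈ range B, ∑ s ∈ range k, p (Δ • (Φ (a + ((m * k + s : ℕ) : ℝ) * Δ) - Φ (a + m * ((b - a) / B)))) :=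
          (seminorm_sum_le p _ _).trans (Finset.sum_le_sum fun m _ => seminorm_sum_le p _ _)
      _ ≤ ∑ m ∈ range B, ∑ s ∈ range k, Δ * ω := by
          refine Finset.sum_le_sum fun m hm => Finset.sum_le_sum fun s hs => ?_
          rw [map_smul_eq_mul, Real.norm_eq_abs, abs_of_nonneg hΔ0]
          refine mul_le_mul_of_nonneg_left (hω _ ?_ _ ?_ ?_) hΔ0
          · have hmB : m < B := Finset.mem_range.1 hm
            have hsk : s < k := Finset.mem_range.1 hs
            have hle : ((m * k + s : ℕ) : ℝ) * Δ ≤ b - a := by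
              have : ((m * k + s : ℕ) : ℝ) ≤ (B * k : ℕ) := by
                exact_mod_cast (by nlinarith : m * k + s ≤ B * k)
              calc ((m * k + s : ℕ) : ℝ) * Δ ≤ (B * k : ℕ) * Δ := by gcongr
                _ = b - a := by rw [hΔ]; field_simp
            exact ⟨by nlinarith [mul_nonneg (Nat.cast_nonneg (m * k + s)) hΔ0], by linarith⟩
          · have hmB : m < B := Finset.mem_range.1 hm
            have hle : (m : ℝ) * ((b - a) / B) ≤ b - a := by
              rw [hΔB]
              have : (m : ℝ) * (k * Δ) = ((m * k : ℕ) : ℝ) * Δ := by push_cast; ring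
              rw [this]
              have : ((m * k : ℕ) : ℝ) ≤ (B * k : ℕ) := by exact_mod_cast Nat.mul_le_mul_right k hmB.le
              calc ((m * k : ℕ) : ℝ) * Δ ≤ (B * k : ℕ) * Δ := by gcongr
                _ = b - a := by rw [hΔ]; field_simp
            have h0 : 0 ≤ (m : ℝ) * ((b - a) / B) := by rw [hΔB]; positivity
            exact ⟨by linarith, by linarith⟩
          · rw [hΔB]
            have hsk : s < k := Finset.mem_range.1 hs
            have : a + ((m * k + s : ℕ) : ℝ) * Δ - (a + m * (k * Δ)) = s * Δ := by push_cast; ring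
            rw [this, abs_of_nonneg (by positivity)]
            exact mul_le_mul_of_nonneg_right (by exact_mod_cast hsk.le) hΔ0
      _ = (b - a) * ω := by
          simp only [Finset.sum_const, Finset.card_range, nsmul_eq_mul]
          rw [hΔ]
          push_cast
          field_simp
  -- (2) `u` is Cauchy
  rw [Literature.Analysis.FunctionSpaces.cauchySeq_schwartzMap_iff]
  intro k l ε hε
  obtain ⟨δ, hδ, hUC⟩ := SchwartzMap.exists_seminorm_sub_lt_of_continuous hΦ a b k l
    (ε := ε / (2 * (b - a) + 1)) (by positivity)
  obtain ⟨n₀, hn₀⟩ : ∃ n₀ : ℕ, (b - a) / (2 ^ n₀ : ℕ) < δ := by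
    obtain ⟨n₀, hn₀⟩ := exists_nat_gt ((b - a) / δ)
    refine ⟨n₀, ?_⟩
    have h2 : (n₀ : ℝ) < (2 ^ n₀ : ℕ) := by exact_mod_cast Nat.lt_two_pow_self
    rw [div_lt_iff₀ (by positivity)]
    rw [div_lt_iff₀ hδ] at hn₀
    nlinarith
  have hnear : ∀ n, n₀ ≤ n → SchwartzMap.seminorm ℝ k l (u n - u n₀) ≤ (b - a) * (ε / (2 * (b - a) + 1)) := by
    intro n hn
    have hpow : 2 ^ n = 2 ^ n₀ * 2 ^ (n - n₀) := by rw [← pow_add, Nat.add_sub_cancel' hn]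
    simp only [hu]
    rw [hpow]
    refine hblock _ (2 ^ n₀) (2 ^ (n - n₀)) (by positivity) (by positivity) _ fun t ht t' ht' htt' =>
      (hUC t ht t' ht' (htt'.trans_lt hn₀)).le
  refine ⟨n₀, fun m hm n hn => ?_⟩
  calc SchwartzMap.seminorm ℝ k l (u n - u m)
      = SchwartzMap.seminorm ℝ k l ((u n - u n₀) - (u m - u n₀)) := by congr 1; abel
    _ ≤ SchwartzMap.seminorm ℝ k l (u n - u n₀) + SchwartzMap.seminorm ℝ k l (u m - u n₀) :=
        map_sub_le_add _ _ _
    _ ≤ (b - a) * (ε / (2 * (b - a) + 1)) + (b - a) * (ε / (2 * (b - a) + 1)) :=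
        add_le_add (hnear n hn) (hnear m hm)
    _ < ε := by
        rw [← two_mul, ← mul_assoc, mul_div_assoc', div_lt_iff₀ (by linarith)]
        nlinarith

/-- Point evaluation along a continuous curve in `𝓢(E, F)` is continuous. [folklore] -/
theorem _root_.SchwartzMap.continuous_apply_of_continuous {Φ : ℝ → 𝓢(E, F)} (hΦ : Continuous Φ)
    (x : E) : Continuous fun t => Φ t x := by
  rw [continuous_iff_continuousAt]
  intro t₀
  rw [ContinuousAt, tendsto_iff_norm_sub_tendsto_zero]
  have hsub : Tendsto (fun t => Φ t - Φ t₀) (𝓝 t₀) (𝓝 0) := by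
    simpa using (hΦ.tendsto t₀).sub (tendsto_const_nhds (x := Φ t₀))
  have hsem : Tendsto (fun t => SchwartzMap.seminorm ℝ 0 0 (Φ t - Φ t₀)) (𝓝 t₀) (𝓝 0) := by
    have := ((schwartz_withSeminorms ℝ E F).continuous_seminorm (0, 0)).tendsto 0
    rw [map_zero] at this
    exact this.comp hsub
  refine squeeze_zero (fun t => norm_nonneg _) (fun t => ?_) hsem
  exact SchwartzMap.norm_le_seminorm ℝ (Φ t - Φ t₀) x

/-- **The Schwartz-valued integral of a continuous curve exists** (Rudin, *Functional
Analysis*, Thm. 3.27, in the complete space `𝓢(E, F)`): for `Φ : ℝ → 𝓢(E, F)` continuous and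
`a ≤ b` there is `Ψ ∈ 𝓢(E, F)` with `Ψ(x) = ∫ₐᵇ Φ t (x) dt` for all `x` — the limit of the
Riemann sums (`SchwartzMap.cauchySeq_riemannSum`, completeness
`Literature.Analysis.FunctionSpaces.completeSpace_schwartzMap`, continuity of point
evaluations). With it, `SchwartzMap.clm_apply_eq_intervalIntegral` and
`SchwartzMap.seminorm_le_intervalIntegral_of_forall_apply_eq_integral` apply to `Ψ`. [folklore] -/
theorem _root_.SchwartzMap.exists_forall_apply_eq_intervalIntegral [CompleteSpace F]
    {Φ : ℝ → 𝓢(E, F)} (hΦ : Continuous Φ) {a b : ℝ} (hab : a ≤ b) :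
    ∃ Ψ : 𝓢(E, F), ∀ x : E, Ψ x = ∫ t in a..b, Φ t x := by
  haveI : CompleteSpace 𝓢(E, F) := Literature.Analysis.FunctionSpaces.completeSpace_schwartzMap
  set u : ℕ → 𝓢(E, F) := fun n => ∑ i ∈ range (2 ^ n), ((b - a) / (2 ^ n : ℕ)) •
    Φ (a + i * ((b - a) / (2 ^ n : ℕ))) with hu
  obtain ⟨Ψ, hΨ⟩ := cauchySeq_tendsto_of_complete (SchwartzMap.cauchySeq_riemannSum hΦ hab)
  change Tendsto u atTop (𝓝 Ψ) at hΨ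
  refine ⟨Ψ, fun x => ?_⟩
  have heval : Tendsto (fun n => u n x) atTop (𝓝 (Ψ x)) := by
    have hsub : Tendsto (fun n => u n - Ψ) atTop (𝓝 0) := by
      have h := hΨ.sub (tendsto_const_nhds (x := Ψ))
      rwa [sub_self] at h
    have hsem : Tendsto (fun n => SchwartzMap.seminorm ℝ 0 0 (u n - Ψ)) atTop (𝓝 0) := by
      have := ((schwartz_withSeminorms ℝ E F).continuous_seminorm (0, 0)).tendsto 0
      rw [map_zero] at this
      exact this.comp hsub
    rw [tendsto_iff_norm_sub_tendsto_zero]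
    refine squeeze_zero (fun n => norm_nonneg _) (fun n => ?_) hsem
    exact SchwartzMap.norm_le_seminorm ℝ (u n - Ψ) x
  have hriem : Tendsto (fun n => u n x) atTop (𝓝 (∫ t in a..b, Φ t x)) := by
    have h := tendsto_riemannSum_intervalIntegral (g := fun t => Φ t x)
      (SchwartzMap.continuous_apply_of_continuous hΦ x) hab
    refine h.congr fun n => ?_
    simp [hu]
  exact tendsto_nhds_unique heval hriem

end Literature.Analysis.Distribution
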